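import Mathlib
import Summits.Ventures.PercRepro2.CrossAPrimeCoinMarkSplit

/-!
# Every coin: the `a₂`-side step is the up-set tilt at `w` plus the growth term
(blind cell PercRepro2, p5 g38; `proofs/subclaims/S4-HARDSTEP.md` §2.4 (s) addendum 47 (2))

For ANY coin `e = {a₂, w}` (random edge at `a₂`, `w` marked or not) the type split of
`CrossAPrimeCoinMarkSplit` (`prob_update_one_split`, with `w` in the role of `o`) writes every
`p¹`-mass as the `p⁰`-mass restricted to `{w ∈ K}` plus the mass of the clusters grown through
the coin (type 2 = `w ∉ K⁰`).  By bilinearity the middle coefficient of the one-edge quadratic is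

  `Φ₀₁ + Φ₁₀ = B_c(m⁰, m⁰|_{w ∈ K}) + B_c(m⁰, m₂′)`          (**`coin_mid_eq_uptilt_add_cross`**)

with `B_c` the symmetric bilinear form of `crossC` (`biForm`; `crossPatC pa pb c = B_c(m(pa), m(pb))`,
`crossPatC_eq_biForm`): the first term is the UP-SET TILT of the closed-coin law at `{K ∋ w}`
(the cluster-event tilt `UPTILT` of S4 addendum 30 (1)), the second the GROWTH term.  Both are
census-true for every coin (kit j336436 / j336438: 5,120 / 5,120 at `c = π` and `c = sup g`);
at a mark `w = o` the tilt dominates the induction hypothesis (`coin_mark_uptilt`).  Own work;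
standard axioms.
-/

namespace Summit.Ventures.PercRepro2

open LeafRowPendantRootSO CrossAPrimeSupport CrossAPrimeA2Route CrossAPrimeA2Induction
  CrossAPrimeExploredBound CrossAPrimeCoinMark

namespace CrossAPrimeCoinSplit

section BiForm

variable {R : Type*} [Field R]

/-- **The symmetric bilinear form of `crossC`** on two mass vectors `(Z, x, y, xv, yv, Dv)`:
`B_c(m, m′) = 2(Z·Dv′ + Z′·Dv) − (y·xv′ + y′·xv) + c(x·y′ + x′·y) − (x·yv′ + x′·yv)`,
so that `B_c(m, m) = 2·crossC`. -/
noncomputable def biForm (Z x y xv yv Dv Z' x' y' xv' yv' Dv' c : R) : R :=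
  2 * (Z * Dv' + Z' * Dv) - (y * xv' + y' * xv) + c * (x * y' + x' * y) - (x * yv' + x' * yv)

/-- `B_c` is additive in its second argument. -/
lemma biForm_add_right (Z x y xv yv Dv Z₁ x₁ y₁ xv₁ yv₁ Dv₁ Z₂ x₂ y₂ xv₂ yv₂ Dv₂ c : R) :
    biForm Z x y xv yv Dv (Z₁ + Z₂) (x₁ + x₂) (y₁ + y₂) (xv₁ + xv₂) (yv₁ + yv₂) (Dv₁ + Dv₂) c =
      biForm Z x y xv yv Dv Z₁ x₁ y₁ xv₁ yv₁ Dv₁ c + biForm Z x y xv yv Dv Z₂ x₂ y₂ xv₂ yv₂ Dv₂ c := by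
  unfold biForm
  ring

end BiForm

section Split

variable {V : Type*} {E : Type*} [Fintype E] [DecidableEq E] {R : Type*} [Field R]
variable {ends : E → Sym2 V}

/-- The two-copy pattern is the bilinear form on the two mass vectors. -/
lemma crossPatC_eq_biForm (pa pb : E → R) (c : R) (o a₁ a₂ v b : V) :
    crossPatC pa pb c ends o a₁ a₂ v b + crossPatC pb pa c ends o a₁ a₂ v b =
      biForm (prob pa (avoidAll ends a₂ {a₁}))
        (prob pa (avoidAll ends a₂ {a₁} ∩ connEvent ends a₂ o))
        (prob pa (avoidAll ends a₂ {a₁} ∩ connEvent ends a₂ b))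
        (prob pa (avoidAll ends a₂ {a₁} ∩ (connEvent ends a₁ v ∩ connEvent ends a₂ o)))
        (prob pa (avoidAll ends a₂ {a₁} ∩ (connEvent ends a₁ v ∩ connEvent ends a₂ b)))
        (prob pa (avoidAll ends a₂ {a₁} ∩
          (connEvent ends a₁ v ∩ (connEvent ends a₂ o ∩ connEvent ends a₂ b))))
        (prob pb (avoidAll ends a₂ {a₁}))
        (prob pb (avoidAll ends a₂ {a₁} ∩ connEvent ends a₂ o))
        (prob pb (avoidAll ends a₂ {a₁} ∩ connEvent ends a₂ b))
        (prob pb (avoidAll ends a₂ {a₁} ∩ (connEvent ends a₁ v ∩ connEvent ends a₂ o)))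
        (prob pb (avoidAll ends a₂ {a₁} ∩ (connEvent ends a₁ v ∩ connEvent ends a₂ b)))
        (prob pb (avoidAll ends a₂ {a₁} ∩
          (connEvent ends a₁ v ∩ (connEvent ends a₂ o ∩ connEvent ends a₂ b)))) c := by
  unfold crossPatC biForm
  ring

omit [Fintype E] in
/-- The flip-invariance of the six mass events of `crossC` along a coin `e = {a₂, w}`. -/
lemma flip_six_events {e : E} {a₂ w : V} (hends : ends e = s(a₂, w)) (o a₁ v b : V) :
    (∀ ω : Config E, Conn ends (Function.update ω e false) a₂ w →
      (Function.update ω e true ∈ avoidAll ends a₂ {a₁} ↔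
        Function.update ω e false ∈ avoidAll ends a₂ {a₁})) ∧
    (∀ ω : Config E, Conn ends (Function.update ω e false) a₂ w →
      (Function.update ω e true ∈ avoidAll ends a₂ {a₁} ∩ connEvent ends a₂ o ↔
        Function.update ω e false ∈ avoidAll ends a₂ {a₁} ∩ connEvent ends a₂ o)) ∧
    (∀ ω : Config E, Conn ends (Function.update ω e false) a₂ w →
      (Function.update ω e true ∈ avoidAll ends a₂ {a₁} ∩ connEvent ends a₂ b ↔
        Function.update ω e false ∈ avoidAll ends a₂ {a₁} ∩ connEvent ends a₂ b)) ∧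
    (∀ ω : Config E, Conn ends (Function.update ω e false) a₂ w →
      (Function.update ω e true ∈
          avoidAll ends a₂ {a₁} ∩ (connEvent ends a₁ v ∩ connEvent ends a₂ o) ↔
        Function.update ω e false ∈
          avoidAll ends a₂ {a₁} ∩ (connEvent ends a₁ v ∩ connEvent ends a₂ o))) ∧
    (∀ ω : Config E, Conn ends (Function.update ω e false) a₂ w →
      (Function.update ω e true ∈
          avoidAll ends a₂ {a₁} ∩ (connEvent ends a₁ v ∩ connEvent ends a₂ b) ↔
        Function.update ω e false ∈
          avoidAll ends a₂ {a₁} ∩ (connEvent ends a₁ v ∩ connEvent ends a₂ b))) ∧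
    (∀ ω : Config E, Conn ends (Function.update ω e false) a₂ w →
      (Function.update ω e true ∈ avoidAll ends a₂ {a₁} ∩
          (connEvent ends a₁ v ∩ (connEvent ends a₂ o ∩ connEvent ends a₂ b)) ↔
        Function.update ω e false ∈ avoidAll ends a₂ {a₁} ∩
          (connEvent ends a₁ v ∩ (connEvent ends a₂ o ∩ connEvent ends a₂ b)))) := by
  refine ⟨fun ω ho => flip_avoidAll_iff hends ho _, fun ω ho => ?_, fun ω ho => ?_,
    fun ω ho => ?_, fun ω ho => ?_, fun ω ho => ?_⟩ <;>
  simp only [Set.mem_inter_iff, flip_avoidAll_iff hends ho, flip_connEvent_iff hends ho]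

/-- **Every coin splits**: along `e = {a₂, w}`,
`Φ₀₁ + Φ₁₀ = B_c(m⁰, m⁰|_{w ∈ K}) + B_c(m⁰, m₂′)` — the up-set tilt of the closed-coin law at
`{K ∋ w}` plus the growth term on the type-2 masses `P¹(· ∩ {w ∉ K⁰})`. -/
theorem coin_mid_eq_uptilt_add_cross (p : E → R) (c : R) {e : E} {a₂ w : V}
    (hends : ends e = s(a₂, w)) (o a₁ v b : V) :
    crossPatC (Function.update p e 0) (Function.update p e 1) c ends o a₁ a₂ v b +
        crossPatC (Function.update p e 1) (Function.update p e 0) c ends o a₁ a₂ v b =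
      biForm (prob (Function.update p e 0) (avoidAll ends a₂ {a₁}))
        (prob (Function.update p e 0) (avoidAll ends a₂ {a₁} ∩ connEvent ends a₂ o))
        (prob (Function.update p e 0) (avoidAll ends a₂ {a₁} ∩ connEvent ends a₂ b))
        (prob (Function.update p e 0)
          (avoidAll ends a₂ {a₁} ∩ (connEvent ends a₁ v ∩ connEvent ends a₂ o)))
        (prob (Function.update p e 0)
          (avoidAll ends a₂ {a₁} ∩ (connEvent ends a₁ v ∩ connEvent ends a₂ b)))
        (prob (Function.update p e 0) (avoidAll ends a₂ {a₁} ∩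
          (connEvent ends a₁ v ∩ (connEvent ends a₂ o ∩ connEvent ends a₂ b))))
        (prob (Function.update p e 0) (avoidAll ends a₂ {a₁} ∩ connEvent ends a₂ w))
        (prob (Function.update p e 0)
          (avoidAll ends a₂ {a₁} ∩ connEvent ends a₂ o ∩ connEvent ends a₂ w))
        (prob (Function.update p e 0)
          (avoidAll ends a₂ {a₁} ∩ connEvent ends a₂ b ∩ connEvent ends a₂ w))
        (prob (Function.update p e 0)
          (avoidAll ends a₂ {a₁} ∩ (connEvent ends a₁ v ∩ connEvent ends a₂ o) ∩
            connEvent ends a₂ w))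
        (prob (Function.update p e 0)
          (avoidAll ends a₂ {a₁} ∩ (connEvent ends a₁ v ∩ connEvent ends a₂ b) ∩
            connEvent ends a₂ w))
        (prob (Function.update p e 0) (avoidAll ends a₂ {a₁} ∩
          (connEvent ends a₁ v ∩ (connEvent ends a₂ o ∩ connEvent ends a₂ b)) ∩
            connEvent ends a₂ w)) c +
      biForm (prob (Function.update p e 0) (avoidAll ends a₂ {a₁}))
        (prob (Function.update p e 0) (avoidAll ends a₂ {a₁} ∩ connEvent ends a₂ o))
        (prob (Function.update p e 0) (avoidAll ends a₂ {a₁} ∩ connEvent ends a₂ b))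
        (prob (Function.update p e 0)
          (avoidAll ends a₂ {a₁} ∩ (connEvent ends a₁ v ∩ connEvent ends a₂ o)))
        (prob (Function.update p e 0)
          (avoidAll ends a₂ {a₁} ∩ (connEvent ends a₁ v ∩ connEvent ends a₂ b)))
        (prob (Function.update p e 0) (avoidAll ends a₂ {a₁} ∩
          (connEvent ends a₁ v ∩ (connEvent ends a₂ o ∩ connEvent ends a₂ b))))
        (prob (Function.update p e 1) (avoidAll ends a₂ {a₁} ∩
          {ω | w ∉ cluster ends (Function.update ω e false) a₂}))
        (prob (Function.update p e 1) (avoidAll ends a₂ {a₁} ∩ connEvent ends a₂ o ∩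
          {ω | w ∉ cluster ends (Function.update ω e false) a₂}))
        (prob (Function.update p e 1) (avoidAll ends a₂ {a₁} ∩ connEvent ends a₂ b ∩
          {ω | w ∉ cluster ends (Function.update ω e false) a₂}))
        (prob (Function.update p e 1)
          (avoidAll ends a₂ {a₁} ∩ (connEvent ends a₁ v ∩ connEvent ends a₂ o) ∩
            {ω | w ∉ cluster ends (Function.update ω e false) a₂}))
        (prob (Function.update p e 1)
          (avoidAll ends a₂ {a₁} ∩ (connEvent ends a₁ v ∩ connEvent ends a₂ b) ∩
            {ω | w ∉ cluster ends (Function.update ω e false) a₂}))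
        (prob (Function.update p e 1) (avoidAll ends a₂ {a₁} ∩
          (connEvent ends a₁ v ∩ (connEvent ends a₂ o ∩ connEvent ends a₂ b)) ∩
            {ω | w ∉ cluster ends (Function.update ω e false) a₂})) c := by
  obtain ⟨hQ, hQo, hQb, hQvo, hQvb, hQvob⟩ := flip_six_events hends o a₁ v b
  rw [crossPatC_eq_biForm, ← biForm_add_right, prob_update_one_split p hQ,
    prob_update_one_split p hQo, prob_update_one_split p hQb, prob_update_one_split p hQvo,
    prob_update_one_split p hQvb, prob_update_one_split p hQvob]

end Split

end CrossAPrimeCoinSplit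

end Summit.Ventures.PercRepro2
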